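import Summits.BirchSwinnertonDyer.Rank1Residual.Additive.AdicIntegersQuotientPrimePowCard
import Summits.BirchSwinnertonDyer.Rank1Residual.Additive.SignedSelmerLevelBridge
import Summits.BirchSwinnertonDyer.Rank1Residual.Additive.TowerStructureLocalIndex
import Summits.BirchSwinnertonDyer.Rank1Residual.GaloisImage.LocalEulerPoincareCharacteristicHolds
import Literature.NumberTheory.GaloisCohomology.PoitouTateSelmerStructuresRealPlaces
import HarnessLib

/-!
# THE COUNT behind (hMW): **`#h₀⁻¹(Sel_{p^∞}(W/ℚ_∞))[p^k] ≤ C · p^k` for every `k`**, with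
# `C = #Sel^{−,str}(W/ℚ_0) · ∏_{ℓ ∈ T} #𝒦_{ℓ,0}[p^∞]` — from the tree's finite-level Poitou–Tate count
# (X5 `relIndex_kummer_update_bot_update_top_eq`) (cell `b2b-bsdres`, CLASS-CLOSURE lane, class O10
# — x1b GEN 43, class lead; file 117 of the series: Step 2 of `HMW-COUNT-PLAN`, the input `hcount` /
# `hfin` of file 115 `exists_pow_smul_eq_zsmul_of_card_torsion_le`)

HONEST FRAMING (cell `b2b-bsdres`, run/shared/lean/b2b/bsd-rank1-residual/, verbatim in every
file): the goal of the cell is to DELETE the COMBINATION-SHAPED residual classes of the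
Birch–Swinnerton-Dyer formula for ALL analytic-rank `≤ 1` elliptic curves over `ℚ` — "full BSD
formula for every rank `≤ 1` curve in class `C`" assembled STRICTLY from published theorems — so
that the rank-`≤ 1` remainder becomes exactly the CONSTRUCTION-SHAPED classes, which are TYPED
(missing-input `Prop`s), NOT attempted. This is not "finishing BSD". CLASS-CLOSURE lane: prove
what is provable now; shrink each hard class to its core with data; no claim beyond stated classes;
research routes on CONSTRUCTION-SHAPED X12 / O10; census / instrument output = EVIDENCE / conjecture
items, NEVER a Literature fact; `RESIDUAL-MAP.md` marks change only by signed lines. THIS FILE: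
TOOL THEOREMS ONLY — no definition, no named Literature fact, no Summits-side fact `def … : Prop`,
no `sorry`, axioms standard; CONDITIONAL (hypothesis `hPT`) on the NAMED FACT
`poitouTate_selmerStructure_duality_real ℚ` (Milne ADT I Thm. 4.10 with the real place; b2b-bsdres-lit
GEN 53) exactly as X5 / files 69, 107, 108; Tate's local Euler characteristic is the tree's THEOREM
`localEulerPoincareCharacteristic_holds`; nothing is booked; no label / mark / count / sub-cell
moves; nothing about `BSD(W, p)` of any pair is claimed.

## What

For `W/ℚ` elliptic, `p` prime, `κ` a `ℤ_p`-extension of `ℚ`, `v₀ = (p)`, a finite set `T ∌ v₀` of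
finite places with `𝒦_{v,0}[p^∞] = 0` off `T ∪ {v₀}` and `𝒦_{w,0}[p^∞]` finite on `T`, granted
`W(ℚ_{v₀})[p] = 0`, `W[p^∞]^{Γ_ℚ} = 0`, `W[p^∞]^{Γ_{ℚ_p}} = 0` and `S₀ = Sel^{−,str}(W/ℚ_0)` (layer `0`
of the strict-minus Selmer group at the model `ℚ_[p]`; `#S₀ = #Sel_str(W/ℚ)[p^∞]`) finite:
* §1 (any number field / module) `0 ≠ [H¹_𝓖 : H¹_𝓕] ≤ ∏_{v ∈ T} [𝓖_v : 𝓕_v]` for `𝓕 ≤ 𝓖` agreeing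
  off `T` (`H¹_𝓖/H¹_𝓕 ↪ ∏ 𝓖_v/𝓕_v`, Mathlib `relIndex_iInf_le`; NO duality);
* §2 `0 ≠ [θ_E⁻¹(𝒦_{E,0}) : 𝓚_E] ≤ #𝒦_{E,0}[p^∞]` at every level (file 75 §1–2);
* §3 **`natCard_selmerInftyPreimage_inf_ker_le`** (`k ≥ 1`): `R_∞[p^k]` finite and
  **`#R_∞[p^k] ≤ (#S₀ · ∏_{w ∈ T} #𝒦_{w,0}[p^∞]) · p^k`**: `#R_∞[p^k] = #H¹_𝓣(ℚ, W[p^k])` (file 72)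
  `≤ #H¹_{𝓣[v₀ ↦ ⊤]} ≤ ∏_T [𝓣_w : 𝓚_w] · #H¹_{𝓚[v₀ ↦ ⊤]}` (§1–2) `= ∏ · p^k · #H¹_{𝓚[v₀ ↦ 0]}` (X5 + EPC
  + `#(ℤ_p/p^k) = p^k`, `W(ℚ_p)[p] = 0`) `≤ ∏ · p^k · #S₀` (`Ψ_k : H¹_{𝓚[v₀ ↦ 0]} ↪ S₀`, file 74);
* §4 the same for every `k ≥ 0` in the `Set.ncard` currency of file 115 (`hfin`, `hcount`).
NOT here: the rank-one discharge (`S₀` finite ⟸ `Ш(W)[p^∞]` finite; `T` for the cyclotomic tower; (hMW)).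

References: [GreenbergLNM1716] §3 (pp. 85–90), §4 Thm. 4.1; [MilneADT2006] I Thm. 4.10, §6;
[Howard2004HeegnerKolyvagin] Thm. 2.1.11; [SilvermanAEC2009] X.§4.
-/

noncomputable section

open scoped Classical

open WeierstrassCurve Literature.NumberTheory.EllipticCurves Literature.NumberTheory.GaloisRepresentations
  NumberField IsDedekindDomain Field Function
open Literature.NumberTheory.GaloisRepresentations.DiscreteGaloisModule (SelmerStructure)
open Literature.NumberTheory.GaloisCohomology
open Literature.NumberTheory.EllipticCurves.Kobayashi2003
open Summit.BirchSwinnertonDyer.Rank1Residual.X11b.Levels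
open Summit.BirchSwinnertonDyer.Rank1Residual.X11b
open Summit.BirchSwinnertonDyer.Rank1Residual.X5.SelfDualCount
open scoped ContRepresentation

namespace Summit.BirchSwinnertonDyer.Rank1Residual.Additive.LevelBridge

universe u

/-! ### §1 Selmer structures agreeing off a finite set: `0 ≠ [H¹_𝓖 : H¹_𝓕] ≤ ∏_{v ∈ T} [𝓖_v : 𝓕_v]` -/

section OffT

variable {K : Type u} [Field K] [NumberField K] {M : Type u} [AddCommGroup M]
  [TopologicalSpace M] [DiscreteTopology M] {ρ : DiscreteGaloisModule K M} {𝓕 𝓖 : SelmerStructure ρ}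

/-- If `𝓕 ≤ 𝓖` agree off the finite set `T` then `H¹_𝓕 = H¹_𝓖 ∩ ⋂_{v ∈ T} loc_v⁻¹(𝓕_v)`. [folklore] -/
theorem selmerGroup_eq_inf_iInf_comap_of_eq_off (hle : 𝓕 ≤ 𝓖) (T : Finset (Place K))
    (heq : ∀ v ∉ T, 𝓕 v = 𝓖 v) :
    𝓕.selmerGroup = 𝓖.selmerGroup ⊓
      ⨅ v : T, (𝓕 (v : Place K)).comap (galoisCohomology.localization ρ (v : Place K) 1) := by
  ext c
  simp only [AddSubgroup.mem_inf, AddSubgroup.mem_iInf, AddSubgroup.mem_comap,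
    SelmerStructure.mem_selmerGroup_iff]
  constructor
  · exact fun h ↦ ⟨fun v ↦ hle v (h v), fun v ↦ h v⟩
  · rintro ⟨h, hT⟩ v
    by_cases hv : v ∈ T
    · exact hT ⟨v, hv⟩
    · rw [heq v hv]; exact h v

/-- **`0 ≠ [H¹_𝓖 : H¹_𝓕] ≤ ∏_{v ∈ T} [𝓖_v : 𝓕_v]`** for Selmer structures `𝓕 ≤ 𝓖` agreeing off a
finite set `T` of places, the local indices on `T` being non-zero (finite): the localisation map
`H¹_𝓖/H¹_𝓕 ↪ ∏_{v ∈ T} 𝓖_v/𝓕_v` is injective (no duality is used).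
[cite: Howard2004HeegnerKolyvagin, Thm. 2.1.11 (arXiv:1202.6340 p. 6), first exact sequence] -/
theorem relIndex_selmerGroup_le_prod_of_eq_off (hle : 𝓕 ≤ 𝓖) (T : Finset (Place K))
    (heq : ∀ v ∉ T, 𝓕 v = 𝓖 v) (hfin : ∀ v ∈ T, (𝓕 v).relIndex (𝓖 v) ≠ 0) :
    𝓕.selmerGroup.relIndex 𝓖.selmerGroup ≠ 0 ∧
      𝓕.selmerGroup.relIndex 𝓖.selmerGroup ≤ ∏ v ∈ T, (𝓕 v).relIndex (𝓖 v) := by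
  rw [selmerGroup_eq_inf_iInf_comap_of_eq_off hle T heq, AddSubgroup.inf_relIndex_left]
  have hloc : ∀ v : T,
      ((𝓕 (v : Place K)).comap (galoisCohomology.localization ρ (v : Place K) 1)).relIndex
          𝓖.selmerGroup ≠ 0 ∧
        ((𝓕 (v : Place K)).comap (galoisCohomology.localization ρ (v : Place K) 1)).relIndex
          𝓖.selmerGroup ≤ (𝓕 (v : Place K)).relIndex (𝓖 (v : Place K)) := fun v ↦ by
    rw [AddSubgroup.relIndex_comap]
    have hKL : 𝓖.selmerGroup.map (galoisCohomology.localization ρ (v : Place K) 1) ≤ 𝓖 (v : Place K) :=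
      AddSubgroup.map_le_iff_le_comap.mpr fun c hc ↦
        AddSubgroup.mem_comap.mpr ((SelmerStructure.mem_selmerGroup_iff 𝓖 c).mp hc (v : Place K))
    exact ⟨fun h0 ↦ hfin v v.2 (AddSubgroup.relIndex_eq_zero_of_le_right hKL h0),
      AddSubgroup.relIndex_le_of_le_right hKL (hfin v v.2)⟩
  refine ⟨AddSubgroup.relIndex_iInf_ne_zero fun v ↦ (hloc v).1,
    (AddSubgroup.relIndex_iInf_le _).trans ?_⟩
  rw [← Finset.prod_coe_sort T]
  exact Finset.prod_le_prod (fun _ _ ↦ Nat.zero_le _) fun v _ ↦ (hloc v).2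

end OffT

/-! ### §2 The index of the Kummer condition in the tower condition is at most `#𝒦_{E,0}[p^∞]` -/

section Local

variable {K : Type u} [Field K] (W : WeierstrassCurve K) (p : ℕ) [hp : Fact p.Prime]
  (κ : ZpExtension K p) (m : ℕ) (E : Type u) [Field E] [Algebra K E]

/-- **`0 ≠ [θ_E⁻¹(𝒦_{E,0}) : 𝓚_E] ≤ #𝒦_{E,0}[p^∞]` at EVERY level `m`** (`𝒦_{E,0}[p^∞]` finite): the
index is `#(𝒦_{E,0} ∩ im θ_E) = #𝒦_{E,0}[p^m]` (file 75 §1–2). [cite: GreenbergLNM1716, §3 Lemma 3.3 (pp. 86–88)] -/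
theorem relIndex_kummer_comap_localTowerKer_le_natCard_primary [CharZero K] [W.IsElliptic]
    [hfin : Finite (W.localTowerKerPrimary κ E 0)] :
    (W.kummerLocalConditionAt ((p ^ m : ℕ) : ℤ) E).relIndex
        ((W.localTowerKer κ E 0).comap
          ((resH1Hom (Literature.NumberTheory.EllipticCurves.subgroupIncl (localSubgroup (κ.layerSubgroup 0) E))
            (AddMonoidHom.id (localPoints W E)) (fun _ _ ↦ rfl)).comp
            (galoisCohomology.map (W.torsionPointsMapIntertwining ((p ^ m : ℕ) : ℤ) E) 1))) ≠ 0 ∧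
    (W.kummerLocalConditionAt ((p ^ m : ℕ) : ℤ) E).relIndex
        ((W.localTowerKer κ E 0).comap
          ((resH1Hom (Literature.NumberTheory.EllipticCurves.subgroupIncl (localSubgroup (κ.layerSubgroup 0) E))
            (AddMonoidHom.id (localPoints W E)) (fun _ _ ↦ rfl)).comp
            (galoisCohomology.map (W.torsionPointsMapIntertwining ((p ^ m : ℕ) : ℤ) E) 1))) ≤
      Nat.card (W.localTowerKerPrimary κ E 0) := by
  rw [← ker_resH1Hom_comp_map_eq_kummerLocalConditionAt W p κ m E, relIndex_ker_comap_eq_natCard_inf_range]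
  have hle : W.localTowerKer κ E 0 ⊓ ((resH1Hom
      (Literature.NumberTheory.EllipticCurves.subgroupIncl (localSubgroup (κ.layerSubgroup 0) E))
        (AddMonoidHom.id (localPoints W E)) (fun _ _ ↦ rfl)).comp
        (galoisCohomology.map (W.torsionPointsMapIntertwining ((p ^ m : ℕ) : ℤ) E) 1)).range ≤
      W.localTowerKerPrimary κ E 0 := fun x hx ↦ by
    rw [mem_inf_range_iff] at hx
    exact (W.mem_localTowerKerPrimary_iff κ E 0 x).mpr ⟨hx.1, m, hx.2⟩
  haveI := Finite.of_injective _ (AddSubgroup.inclusion_injective hle)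
  exact ⟨Nat.card_pos.ne', AddSubgroup.card_le_of_le hle⟩

end Local

/-! ### §3 The count `#R_∞[p^k] ≤ (#S₀ · ∏_{w ∈ T} #𝒦_{w,0}[p^∞]) · p^k` over `ℚ` -/

section Count

variable {G : Type*} [AddCommGroup G]

/-- `#K = #H · [K : H]` for `H ≤ K`. [folklore] -/
theorem natCard_eq_natCard_mul_relIndex_of_le {H K : AddSubgroup G} (h : H ≤ K) :
    Nat.card K = Nat.card H * H.relIndex K := by
  rw [← (H.addSubgroupOf K).card_mul_index, Nat.card_congr (AddSubgroup.addSubgroupOfEquivOfLe h).toEquiv]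
  rfl

/-- A subgroup of finite non-zero index over a finite subgroup is finite. [folklore] -/
theorem finite_of_le_of_relIndex_ne_zero {H K : AddSubgroup G} (h : H ≤ K) [Finite H]
    (hi : H.relIndex K ≠ 0) : Finite K := Nat.finite_of_card_ne_zero
  (by rw [natCard_eq_natCard_mul_relIndex_of_le h]; exact mul_ne_zero Nat.card_pos.ne' hi)

variable (W : WeierstrassCurve ℚ) [W.IsElliptic] {p : ℕ} [hp : Fact p.Prime] (κ : ZpExtension ℚ p)

/-- **THE COUNT.** `#R_∞[p^k] ≤ (#S₀ · ∏_{w ∈ T} #𝒦_{w,0}[p^∞]) · p^k` and `R_∞[p^k]` finite, for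
`k ≥ 1`, `R_∞ = h₀⁻¹(Sel_{p^∞}(W/ℚ_∞))` (`selmerInftyPreimage`), `S₀ = Sel^{−,str}(W/ℚ_0)` at the model
`ℚ_[p]` — granted the named fact `hPT`, `W(ℚ_{v₀})[p] = 0`, `W[p^∞]^{Γ_ℚ} = 0`, `W[p^∞]^{Γ_{ℚ_p}} = 0`,
the exceptional set `T` (`𝒦_{v,0}[p^∞] = 0` off `T ∪ {v₀}`, finite on `T`), `S₀` finite, and `K`-algebra
maps `ℚ_{v₀} ⇄ ℚ_[p]`. Chain: `#R_∞[p^k] = #H¹_𝓣(ℚ, W[p^k]) ≤ #H¹_{𝓣[v₀ ↦ ⊤]} ≤ ∏[𝓣_w : 𝓚_w]·#H¹_{𝓚[v₀ ↦ ⊤]}`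
`= ∏ · p^k · #H¹_{𝓚[v₀ ↦ 0]} ≤ ∏ · p^k · #S₀`. [cite: GreenbergLNM1716, §3 (pp. 85–90) and §4 Thm. 4.1]
[cite: MilneADT2006, Ch. I, Thm. 4.10] [cite: Howard2004HeegnerKolyvagin, Thm. 2.1.11] -/
theorem natCard_selmerInftyPreimage_inf_ker_le
    (hPT : poitouTate_selmerStructure_duality_real ℚ)
    (v₀ : HeightOneSpectrum (𝓞 ℚ)) (hv₀ : (Rat.HeightOneSpectrum.primesEquiv (R := 𝓞 ℚ)).symm ⟨p, hp.out⟩ = v₀)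
    [Algebra (v₀.adicCompletion ℚ) ℚ_[p]] [IsScalarTower ℚ (v₀.adicCompletion ℚ) ℚ_[p]]
    [Algebra ℚ_[p] (v₀.adicCompletion ℚ)] [IsScalarTower ℚ ℚ_[p] (v₀.adicCompletion ℚ)]
    (htors : ∀ X : (W.baseChange (v₀.adicCompletion ℚ)).toAffine.Point, p • X = 0 → X = 0)
    (hΓ : ∀ Q : W.geomPrimaryTorsion p,
      (∀ σ : absoluteGaloisGroup ℚ, X11b.LocBridge.primaryGaloisModule W p σ Q = Q) → Q = 0)
    (hΓE : ∀ Q : W.geomPrimaryTorsion p, (∀ σ : absoluteGaloisGroup ℚ_[p],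
      GaloisRep.restrictField ℚ_[p] (LocBridge.primaryGaloisModule W p) σ Q = Q) → Q = 0)
    (T : Finset (HeightOneSpectrum (𝓞 ℚ))) (hv₀T : v₀ ∉ T)
    (hT0 : ∀ v : HeightOneSpectrum (𝓞 ℚ), v ∉ T → v ≠ v₀ → W.localTowerKerPrimary κ (v.adicCompletion ℚ) 0 = ⊥)
    (hTfin : ∀ w ∈ T, Finite (W.localTowerKerPrimary κ (w.adicCompletion ℚ) 0))
    [hS₀ : Finite (strictSignedSelmerLayer W κ ℚ_[p] (-1) 0)]
    {k : ℕ} (hk : 1 ≤ k) :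
    Finite ↥(W.selmerInftyPreimage κ 0 ⊓ (nsmulAddMonoidHom (p ^ k) :
        W.subgroupH1 p (κ.layerSubgroup 0) →+ _).ker) ∧
    Nat.card ↥(W.selmerInftyPreimage κ 0 ⊓ (nsmulAddMonoidHom (p ^ k) :
        W.subgroupH1 p (κ.layerSubgroup 0) →+ _).ker) ≤
      (Nat.card (strictSignedSelmerLayer W κ ℚ_[p] (-1) 0) *
        ∏ w ∈ T, Nat.card (W.localTowerKerPrimary κ (w.adicCompletion ℚ) 0)) * p ^ k := by
  haveI : NeZero (p ^ k) := ⟨pow_ne_zero k hp.out.ne_zero⟩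
  have hn : IsPrimePow (p ^ k) := (isPrimePow_nat_iff (p ^ k)).mpr ⟨p, k, hp.out, hk, rfl⟩
  have hdiv : W.zsmul_geomPoints_surjective := W.zsmul_geomPoints_surjective_holds
  obtain ⟨inv, hperf, hvan, -, hcomp, hreal⟩ := exists_localInvariants_injective_inl_of_real hPT (p ^ k)
  have hEP : ∀ v : HeightOneSpectrum (𝓞 ℚ), localEulerPoincareCharacteristic (v.adicCompletion ℚ) :=
    fun v ↦ by
      haveI : CharZero (v.adicCompletion ℚ) :=
        Literature.NumberTheory.GaloisRepresentations.charZero_adicCompletion v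
      exact localEulerPoincareCharacteristic_holds (v.adicCompletion ℚ)
  have hvp : (Rat.HeightOneSpectrum.primesEquiv v₀ : ℕ) = p := by
    rw [← hv₀, Equiv.apply_symm_apply]
  set Ψ : galoisCohomology (W.torsionGaloisModule ((p ^ k : ℕ) : ℤ)) 1 → W.subgroupH1 p (κ.layerSubgroup 0) :=
    fun c ↦ resH1Hom (Literature.NumberTheory.EllipticCurves.subgroupIncl (κ.layerSubgroup 0)) (AddMonoidHom.id (geomPrimaryTorsion W p))
      (fun _ _ ↦ rfl) (galoisCohomology.map (primaryInclusion W p k) 1 c) with hΨ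
  have hΨinj : Function.Injective Ψ := levelToLayerZero_injective W p κ k hΓ
  set A := W.selmerInftyPreimage κ 0 ⊓ (nsmulAddMonoidHom (p ^ k) :
    W.subgroupH1 p (κ.layerSubgroup 0) →+ _).ker with hA
  have hAk : ∀ z ∈ A, p ^ k • z = 0 := fun z hz ↦ by
    have h := (AddSubgroup.mem_inf.mp hz).2
    rwa [AddMonoidHom.mem_ker, nsmulAddMonoidHom_apply] at h
  set 𝓚 : SelmerStructure (W.torsionGaloisModule ((p ^ k : ℕ) : ℤ)) :=
    W.kummerSelmerStructure ((p ^ k : ℕ) : ℤ) with h𝓚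
  let 𝓣 : SelmerStructure (W.torsionGaloisModule ((p ^ k : ℕ) : ℤ)) := fun v ↦
    match v with
    | Sum.inl w => W.kummerSelmerStructure ((p ^ k : ℕ) : ℤ) (Sum.inl w)
    | Sum.inr v => (W.localTowerKer κ (v.adicCompletion ℚ) 0).comap
        ((resH1Hom (Literature.NumberTheory.EllipticCurves.subgroupIncl
            (localSubgroup (κ.layerSubgroup 0) (v.adicCompletion ℚ)))
          (AddMonoidHom.id (localPoints W (v.adicCompletion ℚ))) (fun _ _ ↦ rfl)).comp
          (galoisCohomology.map
            (W.torsionPointsMapIntertwining ((p ^ k : ℕ) : ℤ) (v.adicCompletion ℚ)) 1))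
  have h𝓣fin : ∀ v : HeightOneSpectrum (𝓞 ℚ), 𝓣 (Sum.inr v) =
      (W.localTowerKer κ (v.adicCompletion ℚ) 0).comap
        ((resH1Hom (Literature.NumberTheory.EllipticCurves.subgroupIncl
            (localSubgroup (κ.layerSubgroup 0) (v.adicCompletion ℚ)))
          (AddMonoidHom.id (localPoints W (v.adicCompletion ℚ))) (fun _ _ ↦ rfl)).comp
          (galoisCohomology.map
            (W.torsionPointsMapIntertwining ((p ^ k : ℕ) : ℤ) (v.adicCompletion ℚ)) 1)) := fun _ ↦ rfl
  have h𝓣inf : ∀ w : InfinitePlace ℚ, 𝓣 (Sum.inl w) = W.kummerSelmerStructure ((p ^ k : ℕ) : ℤ) (Sum.inl w) :=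
    fun _ ↦ rfl
  set 𝓣t : SelmerStructure (W.torsionGaloisModule ((p ^ k : ℕ) : ℤ)) :=
    Function.update 𝓣 (Sum.inr v₀) ⊤ with h𝓣t
  set 𝓚t : SelmerStructure (W.torsionGaloisModule ((p ^ k : ℕ) : ℤ)) :=
    Function.update 𝓚 (Sum.inr v₀) ⊤ with h𝓚t
  set 𝓚b : SelmerStructure (W.torsionGaloisModule ((p ^ k : ℕ) : ℤ)) :=
    Function.update 𝓚 (Sum.inr v₀) ⊥ with h𝓚b
  -- (1) `#A = #H¹_𝓣`
  have hmem𝓣 : ∀ c, c ∈ 𝓣.selmerGroup ↔ Ψ c ∈ A := fun c ↦ by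
    rw [mem_selmerGroup_iff_levelToLayerZero_mem_selmerInftyPreimage W p κ k 𝓣 h𝓣fin h𝓣inf c, hA,
      AddSubgroup.mem_inf, AddMonoidHom.mem_ker, nsmulAddMonoidHom_apply]
    exact ⟨fun h ↦ ⟨h, pow_smul_levelToLayerZero_eq_zero W p κ k c⟩, fun h ↦ h.1⟩
  have hcardA : Nat.card 𝓣.selmerGroup = Nat.card A :=
    natCard_selmerGroup_eq_of_iff W p κ k hdiv hΓ 𝓣 A hAk hmem𝓣
  -- (2) the strict Kummer structure injects into `S₀` along `Ψ_k`
  have hmemb : ∀ c, c ∈ 𝓚b.selmerGroup ↔ Ψ c ∈ strictSignedSelmerLayer W κ ℚ_[p] (-1) 0 := fun c ↦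
    mem_selmerGroup_update_bot_iff_levelToLayerZero_mem_strictSignedSelmerLayer W p κ k v₀ ℚ_[p] hΓE c
  have hinjb : Function.Injective fun c : 𝓚b.selmerGroup ↦
      (⟨Ψ c, (hmemb c).mp c.2⟩ : strictSignedSelmerLayer W κ ℚ_[p] (-1) 0) := fun c c' h ↦
    Subtype.ext (hΨinj (congrArg Subtype.val h))
  haveI hfinb : Finite 𝓚b.selmerGroup := Finite.of_injective _ hinjb
  have hcardb : Nat.card 𝓚b.selmerGroup ≤ Nat.card (strictSignedSelmerLayer W κ ℚ_[p] (-1) 0) :=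
    Nat.card_le_card_of_injective _ hinjb
  -- (3) X5: `[H¹_{𝓚[v₀ ↦ ⊤]} : H¹_{𝓚[v₀ ↦ 0]}] = #W(ℚ_{v₀})[p^k] · #(ℤ_p/p^k) = p^k`
  have hcount := relIndex_kummer_update_bot_update_top_eq W (p ^ k) hn inv hperf hvan hcomp hEP hreal v₀
  rw [DefectCountFiniteLevel.natCard_ker_nsmul_pow_eq_one htors, one_mul,
    DefectCountFiniteLevel.natCard_quot_adicCompletionIntegers_prime_pow_rat hvp k] at hcount
  have hbt : 𝓚b.selmerGroup ≤ 𝓚t.selmerGroup := fun c hc ↦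
    (SelmerStructure.mem_selmerGroup_iff 𝓚t c).mpr fun v ↦ by
      by_cases hv : v = Sum.inr v₀
      · subst hv; rw [h𝓚t, Function.update_self]; exact AddSubgroup.mem_top _
      · rw [h𝓚t, Function.update_of_ne hv]
        have h := (SelmerStructure.mem_selmerGroup_iff 𝓚b c).mp hc v
        rwa [h𝓚b, Function.update_of_ne hv] at h
  have hcardt : Nat.card 𝓚t.selmerGroup = Nat.card 𝓚b.selmerGroup * p ^ k := by
    rw [natCard_eq_natCard_mul_relIndex_of_le hbt]
    exact congrArg _ hcount
  haveI hfint : Finite 𝓚t.selmerGroup :=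
    finite_of_le_of_relIndex_ne_zero hbt (by rw [hcount]; exact NeZero.ne _)
  -- (4) `𝓚[v₀ ↦ ⊤] ≤ 𝓣[v₀ ↦ ⊤]`, equal off `T`, with finite local indices `≤ #𝒦_{w,0}[p^∞]` on `T`
  have hle : 𝓚t ≤ 𝓣t := fun v ↦ by
    by_cases hv : v = Sum.inr v₀
    · subst hv; rw [h𝓚t, h𝓣t, Function.update_self, Function.update_self]
    · rw [h𝓚t, h𝓣t, Function.update_of_ne hv, Function.update_of_ne hv]
      rcases v with w | v
      · exact le_of_eq (h𝓣inf w).symm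
      · rw [h𝓣fin v]; exact kummerSelmerStructure_inr_le_comap_localTowerKer W p κ k v
  have heq : ∀ v ∉ T.map ⟨Sum.inr, Sum.inr_injective⟩, 𝓚t v = 𝓣t v := fun v hv ↦ by
    by_cases hv₀ : v = Sum.inr v₀
    · subst hv₀; rw [h𝓚t, h𝓣t, Function.update_self, Function.update_self]
    · rw [h𝓚t, h𝓣t, Function.update_of_ne hv₀, Function.update_of_ne hv₀]
      refine (eq_kummerSelmerStructure_of_not_mem W p κ k 𝓣 h𝓣fin h𝓣inf (↑T ∪ {v₀}) (fun w hw ↦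
        hT0 w (fun h ↦ hw (Set.mem_union_left _ h)) (fun h ↦ hw (Set.mem_union_right _ h))) v ?_).symm
      intro w hw h
      rcases hw with hw | hw
      · exact hv (h ▸ Finset.mem_map.mpr ⟨w, hw, rfl⟩)
      · exact hv₀ (h ▸ congrArg Sum.inr hw)
  have hidx : ∀ w ∈ T, (𝓚t (Sum.inr w)).relIndex (𝓣t (Sum.inr w)) ≠ 0 ∧
      (𝓚t (Sum.inr w)).relIndex (𝓣t (Sum.inr w)) ≤
        Nat.card (W.localTowerKerPrimary κ (w.adicCompletion ℚ) 0) := by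
    intro w hw
    have hne : (Sum.inr w : Place ℚ) ≠ Sum.inr v₀ := fun h ↦ hv₀T ((Sum.inr_injective h) ▸ hw)
    haveI := hTfin w hw
    rw [h𝓚t, h𝓣t, Function.update_of_ne hne, Function.update_of_ne hne, h𝓣fin w, h𝓚,
      kummerSelmerStructure_apply]
    exact relIndex_kummer_comap_localTowerKer_le_natCard_primary W p κ k (w.adicCompletion ℚ)
  obtain ⟨hrel0, hrel⟩ := relIndex_selmerGroup_le_prod_of_eq_off hle _ heq fun v hv ↦ by
    obtain ⟨w, hw, rfl⟩ := Finset.mem_map.mp hv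
    exact (hidx w hw).1
  have hprod : ∏ v ∈ T.map ⟨Sum.inr, Sum.inr_injective⟩, (𝓚t v).relIndex (𝓣t v) ≤
      ∏ w ∈ T, Nat.card (W.localTowerKerPrimary κ (w.adicCompletion ℚ) 0) := by
    rw [Finset.prod_map]
    exact Finset.prod_le_prod (fun _ _ ↦ Nat.zero_le _) fun w hw ↦ (hidx w hw).2
  have hst : 𝓚t.selmerGroup ≤ 𝓣t.selmerGroup := fun c hc ↦
    (SelmerStructure.mem_selmerGroup_iff 𝓣t c).mpr fun v ↦
      hle v ((SelmerStructure.mem_selmerGroup_iff 𝓚t c).mp hc v)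
  haveI hfinTt : Finite 𝓣t.selmerGroup := finite_of_le_of_relIndex_ne_zero hst hrel0
  have hcardTt : Nat.card 𝓣t.selmerGroup ≤ Nat.card 𝓚t.selmerGroup *
      ∏ w ∈ T, Nat.card (W.localTowerKerPrimary κ (w.adicCompletion ℚ) 0) := by
    rw [natCard_eq_natCard_mul_relIndex_of_le hst]
    exact Nat.mul_le_mul_left _ (hrel.trans hprod)
  -- (5) `H¹_𝓣 ≤ H¹_{𝓣[v₀ ↦ ⊤]}`
  have h𝓣le : 𝓣.selmerGroup ≤ 𝓣t.selmerGroup := fun c hc ↦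
    (SelmerStructure.mem_selmerGroup_iff 𝓣t c).mpr fun v ↦ by
      by_cases hv : v = Sum.inr v₀
      · subst hv; rw [h𝓣t, Function.update_self]; exact AddSubgroup.mem_top _
      · rw [h𝓣t, Function.update_of_ne hv]
        exact (SelmerStructure.mem_selmerGroup_iff 𝓣 c).mp hc v
  haveI hfin𝓣 : Finite 𝓣.selmerGroup := Finite.of_injective _ (AddSubgroup.inclusion_injective h𝓣le)
  have hcard𝓣 : Nat.card 𝓣.selmerGroup ≤ Nat.card 𝓣t.selmerGroup := AddSubgroup.card_le_of_le h𝓣le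
  refine ⟨Nat.finite_of_card_ne_zero (hcardA ▸ Nat.card_pos.ne'), ?_⟩
  rw [← hcardA]
  calc Nat.card 𝓣.selmerGroup
      ≤ Nat.card 𝓣t.selmerGroup := hcard𝓣
    _ ≤ Nat.card 𝓚t.selmerGroup * ∏ w ∈ T, Nat.card (W.localTowerKerPrimary κ (w.adicCompletion ℚ) 0) :=
        hcardTt
    _ = Nat.card 𝓚b.selmerGroup * p ^ k *
          ∏ w ∈ T, Nat.card (W.localTowerKerPrimary κ (w.adicCompletion ℚ) 0) := by rw [hcardt]
    _ ≤ Nat.card (strictSignedSelmerLayer W κ ℚ_[p] (-1) 0) * p ^ k *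
          ∏ w ∈ T, Nat.card (W.localTowerKerPrimary κ (w.adicCompletion ℚ) 0) :=
        Nat.mul_le_mul_right _ (Nat.mul_le_mul_right _ hcardb)
    _ = (Nat.card (strictSignedSelmerLayer W κ ℚ_[p] (-1) 0) *
          ∏ w ∈ T, Nat.card (W.localTowerKerPrimary κ (w.adicCompletion ℚ) 0)) * p ^ k := by ring

/-! ### §4 In the currency of file 115: `R_∞[p^k]` finite and `#R_∞[p^k] ≤ C · p^k` for EVERY `k` -/

/-- **The inputs `hfin`, `hcount` of file 115 `exists_pow_smul_eq_zsmul_of_card_torsion_le`** for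
`R = R_∞ = h₀⁻¹(Sel_{p^∞}(W/ℚ_∞))` and **`C = #S₀ · ∏_{w ∈ T} #𝒦_{w,0}[p^∞]`**: for every `k ≥ 0` the set
`{y ∈ R_∞ | p^k·y = 0}` is finite of size `≤ C · p^k` (§3 for `k ≥ 1`; `{0}` and `C ≥ 1` for `k = 0`).
Same hypotheses and CONDITIONALITY (`hPT`) as §3. [cite: GreenbergLNM1716, §3 (pp. 85–90) and §4 Thm. 4.1]
[cite: MilneADT2006, Ch. I, Thm. 4.10] -/
theorem finite_and_ncard_selmerInftyPreimage_torsion_le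
    (hPT : poitouTate_selmerStructure_duality_real ℚ)
    (v₀ : HeightOneSpectrum (𝓞 ℚ)) (hv₀ : (Rat.HeightOneSpectrum.primesEquiv (R := 𝓞 ℚ)).symm ⟨p, hp.out⟩ = v₀)
    [Algebra (v₀.adicCompletion ℚ) ℚ_[p]] [IsScalarTower ℚ (v₀.adicCompletion ℚ) ℚ_[p]]
    [Algebra ℚ_[p] (v₀.adicCompletion ℚ)] [IsScalarTower ℚ ℚ_[p] (v₀.adicCompletion ℚ)]
    (htors : ∀ X : (W.baseChange (v₀.adicCompletion ℚ)).toAffine.Point, p • X = 0 → X = 0)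
    (hΓ : ∀ Q : W.geomPrimaryTorsion p,
      (∀ σ : absoluteGaloisGroup ℚ, X11b.LocBridge.primaryGaloisModule W p σ Q = Q) → Q = 0)
    (hΓE : ∀ Q : W.geomPrimaryTorsion p, (∀ σ : absoluteGaloisGroup ℚ_[p],
      GaloisRep.restrictField ℚ_[p] (LocBridge.primaryGaloisModule W p) σ Q = Q) → Q = 0)
    (T : Finset (HeightOneSpectrum (𝓞 ℚ))) (hv₀T : v₀ ∉ T)
    (hT0 : ∀ v : HeightOneSpectrum (𝓞 ℚ), v ∉ T → v ≠ v₀ → W.localTowerKerPrimary κ (v.adicCompletion ℚ) 0 = ⊥)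
    (hTfin : ∀ w ∈ T, Finite (W.localTowerKerPrimary κ (w.adicCompletion ℚ) 0))
    [hS₀ : Finite (strictSignedSelmerLayer W κ ℚ_[p] (-1) 0)] (k : ℕ) :
    Set.Finite {y : W.subgroupH1 p (κ.layerSubgroup 0) | y ∈ W.selmerInftyPreimage κ 0 ∧ p ^ k • y = 0} ∧
    Set.ncard {y : W.subgroupH1 p (κ.layerSubgroup 0) | y ∈ W.selmerInftyPreimage κ 0 ∧ p ^ k • y = 0} ≤
      (Nat.card (strictSignedSelmerLayer W κ ℚ_[p] (-1) 0) *
        ∏ w ∈ T, Nat.card (W.localTowerKerPrimary κ (w.adicCompletion ℚ) 0)) * p ^ k := by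
  rcases Nat.eq_zero_or_pos k with rfl | hk
  · -- `k = 0`: the set is `{0}` and `C ≥ 1`
    have h0 : {y : W.subgroupH1 p (κ.layerSubgroup 0) | y ∈ W.selmerInftyPreimage κ 0 ∧ p ^ 0 • y = 0} =
        {0} := by
      ext y
      simp only [pow_zero, one_smul, Set.mem_setOf_eq, Set.mem_singleton_iff]
      exact ⟨fun h ↦ h.2, fun h ↦ ⟨h ▸ zero_mem _, h⟩⟩
    rw [h0, pow_zero, mul_one, Set.ncard_singleton]
    refine ⟨Set.finite_singleton 0, Nat.one_le_iff_ne_zero.mpr (mul_ne_zero Nat.card_pos.ne' ?_)⟩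
    exact Finset.prod_ne_zero_iff.mpr fun w hw ↦ by
      haveI := hTfin w hw
      haveI : Nonempty (W.localTowerKerPrimary κ (w.adicCompletion ℚ) 0) := ⟨0⟩
      exact Nat.card_pos.ne'
  · have hset : {y : W.subgroupH1 p (κ.layerSubgroup 0) | y ∈ W.selmerInftyPreimage κ 0 ∧ p ^ k • y = 0} =
        ↑(W.selmerInftyPreimage κ 0 ⊓ (nsmulAddMonoidHom (p ^ k) :
          W.subgroupH1 p (κ.layerSubgroup 0) →+ _).ker) := by
      ext y
      simp only [Set.mem_setOf_eq, SetLike.mem_coe, AddSubgroup.mem_inf, AddMonoidHom.mem_ker,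
        nsmulAddMonoidHom_apply]
    obtain ⟨hfin, hle⟩ := natCard_selmerInftyPreimage_inf_ker_le W κ hPT v₀ hv₀ htors hΓ hΓE T hv₀T hT0
      hTfin hk
    haveI : Finite ↥(↑(W.selmerInftyPreimage κ 0 ⊓ (nsmulAddMonoidHom (p ^ k) :
        W.subgroupH1 p (κ.layerSubgroup 0) →+ _).ker) : Set (W.subgroupH1 p (κ.layerSubgroup 0))) := hfin
    rw [hset, ← Nat.card_coe_set_eq]
    exact ⟨Set.toFinite _, hle⟩

end Count

end Summit.BirchSwinnertonDyer.Rank1Residual.Additive.LevelBridge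

end
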